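import Literature.AnabelianGeometry.AbsoluteAnabelian.MonoidKummerMapsProp32iChainModel
import Literature.AnabelianGeometry.AbsoluteAnabelian.LocalResidueMapQmodZTorsion
import Literature.AnabelianGeometry.AbsoluteAnabelian.MonoidKummerMapsEndQmodZ
import Literature.AnabelianGeometry.AbsoluteAnabelian.CyclotomicSynchronizationCor110iaProofs
import HarnessLib

/-!
# [AbsTopIII] Prop 3.2 (i) for the MODEL with the GENUINE `H²`-slot `H²(G_k, μ_Ẑ(G_k))`

S. Mochizuki, *Topics in absolute anabelian geometry III* (2015), Prop. 3.2 (i) p. 71 l. 18–21, 57–60: «a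
functorial algorithm for constructing the natural isomorphism `H²(G, μ_Ẑ(M_TM)) ⥲ Ẑ`» — via the Brauer chain
to «the resulting isomorphism `H²(G, μ_{ℚ/ℤ}(M_TM)) ⥲ ℚ/ℤ`» and «applying the functor `Hom(ℚ/ℤ, −)`».
Sub-DAG `plan/L4/SUBDAG-AbsTopIII-Prop32.md`, node AbsTopIII:Prop3.2(i), sub-row «Prop32i-GENUINE-H2»
(spec abc-iut-w4-d045, HOME/HANDOFF.md 2026-08-26T08:16:46Z; seat abc-iut-w6-d075).

abc-iut-L4-t2's model Kummer theory `ModelMLFGaloisData.kummerTheory` (`MonoidKummerModel.lean`) fills the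
`H²`-slot of `ContCohomologyData` with the PLACEHOLDER `Ẑ` and `h2Iso := id`; abc-iut-w4-d045's
`Prop121vii.modelChainStd` (`MonoidKummerMapsProp32iChainModel.lean`) instantiated the printed chain against that
placeholder.  Here the slot is the GENUINE continuous cohomology group
`galCyclotomeH2 Γ_k = H²(Γ_k, μ_Ẑ(G_k))` of abc-iut-L4-t1's group-theoretic cyclotome (`CyclotomicSynchronization.lean`;
`μ_Ẑ(G_k)` is identified with `Λ(k̄ˣ) = μ_Ẑ(M)` through a torsion-reciprocity datum `R` — Rmk. 3.2.1's
synchronisation, `TorsionReciprocityData.muZhatEquiv`), and `h2Iso` is THE `Ẑ`-level residue isomorphism obtained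
exactly as print says:

  `H²(Γ_k, μ_Ẑ(G_k)) ⥲ lim_i H²(Γ_k, μ_{(i+1)!})` (`DiscreteTowerPresentation.limitClassesEquiv` for
  `galCyclotomeTower R.equiv R.equiv_smul`, abc-iut-L4-t17; NSW (2.7.6), `finite_H1_galCyclotomeTower`)
  `= H2MuChainClasses k` (`limitClasses_galCyclotomeTower`) `⥲ Hom(ℚ/ℤ, H²(Γ_k, μ_{ℚ/ℤ}))`
  (`H2MuQZ.homQmodZChainEquiv⁻¹`, `LocalResidueMapQmodZTorsion.lean`) `⥲ Hom(ℚ/ℤ, ℚ/ℤ)` (`Hom(ℚ/ℤ, inv)` for THE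
  residue isomorphism `invariantQZEquiv`) `⥲ Ẑ` (`eEnd`, canonically `Prop32iChain.endQmodZCanonical`).

* `Prop121vii.genuineH2HomQmodZEquiv R : H²(Γ_k, μ_Ẑ(G_k)) ≃+ Hom(ℚ/ℤ, H²(Γ_k, μ_{ℚ/ℤ}))`, `genuineH2Iso R eEnd`;
* `ModelMLFGaloisData.genuineKummerTheory` — `D.kummerTheory` with `coh.H2 := H²(Γ_k, μ_Ẑ(G_k))`, `h2Iso :=
  genuineH2Iso` (Kummer maps, limit map, additive structure re-used verbatim: `ContCohomologyData.H2` is an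
  independent field);
* `Prop121vii.genuineChain` / `genuineChainStd` — the printed chain `Prop32iChain` over it (Brauer arrows as in
  `modelChain`, `homQmodZ := genuineH2HomQmodZEquiv⁻¹`), and THE CRITERION `genuineChain_h2IsoEq_iff`:
  `H2IsoEq` («the output `h2Iso` IS the chain composite») iff the Brauer-route composite IS the residue map —
  whence `genuineChainStd_neg_h2IsoEq` (HOLDS with the orientation `ε = −id`) and
  `not_genuineChainStd_refl_h2IsoEq` (fails by the tree's sign convention with `ε = id`), exactly as for the
  placeholder (`modelChainStd_neg_h2IsoEq` / `not_modelChainStd_refl_h2IsoEq`).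

* `natCast_dvd_repn_genuineH2Iso_sub_invLevel` / `…_sub_limitClassesEquivZModChain`: `genuineH2Iso` READ LEVELWISE —
  its `ℤ/(i+1)!`-coordinate is `inv_{(i+1)!}` of the push-forward of the class to `H²(Γ_k, μ_{(i+1)!})`, i.e. the
  `Hom(ℚ/ℤ, −)`-route coincides level by level with abc-iut-L4-t17's `limitClassesEquivZModChain` (F-1387,
  `CyclotomicSynchronizationCor110iaProofs.lean`): the two printed descriptions of «`H²(G_k, μ_Ẑ(G_k)) ⥲ Ẑ`» agree.

RELATION TO abc-iut-L4-t2's `ModelMLFGaloisData.kummerTheoryStd` (`MonoidKummerModelH2.lean`): that refill takes the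
`H²`-slot to be `H²_cont(G_k, Ẑ(1))` of the FIELD-theoretic Tate module (abc-iut-L4-t11/t16's
`continuousCohomologyTwoTateModuleEquiv ≫ cohomologyLimitMuEquivZHat`); the present file takes abc-iut-L4-t17's
GROUP-theoretic `galCyclotomeH2` (the object of F-1387) and, in addition, instantiates the printed CHAIN over it
with `H2IsoEq` proved — the identification of the two real `H²`'s is the two-towers junction (abc-iut-w4-d045).
HONEST FRAMING: local class field theory and Galois-cohomology bookkeeping, all inputs kernel theorems of the
tree; the sign is a statement about the TREE's normalisations, not about print; model-level; nothing here bears on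
[IUTchIII] Cor. 3.12 or takes a side; typed ≠ proved.
-/

noncomputable section

namespace Literature.AnabelianGeometry.AbsoluteAnabelian

open CategoryTheory Field Function
open Literature.NumberTheory.GaloisRepresentations
open Literature.NumberTheory.GaloisRepresentations.DiscreteGaloisModule

namespace Prop121vii

variable (k : Type) [Field k] [ValuativeRel k] [TopologicalSpace k] [IsNonarchimedeanLocalField k] [CharZero k]
variable (R : TorsionReciprocityData k)

/-! ### (S3) + (S2): `H²(Γ_k, μ_Ẑ(G_k)) ≃ Hom(ℚ/ℤ, H²(Γ_k, μ_{ℚ/ℤ}))` -/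

/-- **`H²(Γ_k, μ_Ẑ(G_k)) ⥲ lim_i H²(Γ_k, μ_{(i+1)!}) = H2MuChainClasses k`** (NSW (2.7.6) for the factorial tower
of `μ_Ẑ(G_k)` presented through the torsion-reciprocity datum `R`, read comparison-free).
[cite: MochizukiAbsTopIII2015, Cor 1.10 (i) p.42] -/
def genuineH2ChainEquiv : (galCyclotomeH2 (absoluteGaloisGroup k) : Type) ≃+ H2MuChainClasses k :=
  ((galCyclotomeTower R.equiv R.equiv_smul).limitClassesEquiv
      (finite_H1_galCyclotomeTower k R.equiv R.equiv_smul)).trans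
    (AddEquiv.addSubgroupCongr (limitClasses_galCyclotomeTower R.equiv R.equiv_smul))

/-- Components: the `i`-th level class of `c ∈ H²(Γ_k, μ_Ẑ(G_k))` is its push-forward along the projection
`μ_Ẑ(G_k) → μ_{(i+1)!}(k̄)`. [cite: MochizukiAbsTopIII2015, Cor 1.10 (i) p.42] -/
theorem genuineH2ChainEquiv_apply_coe (c : (galCyclotomeH2 (absoluteGaloisGroup k) : Type)) (i : ℕ) :
    (genuineH2ChainEquiv k R c : ∀ i, galoisCohomology (mu k ((cycLevel i : ℕ+) : ℕ)) 2) i =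
      cohomologyMap ((galCyclotomeTower R.equiv R.equiv_smul).proj i) 2 c := rfl

/-- **«applying the functor `Hom(ℚ/ℤ, −)`», genuinely: `H²(Γ_k, μ_Ẑ(G_k)) ≃ Hom(ℚ/ℤ, H²(Γ_k, μ_{ℚ/ℤ}))`**
(`= lim_i H²(Γ_k, μ_{(i+1)!})` by NSW (2.7.6), `= Hom(ℚ/ℤ, colim_n H²(Γ_k, μ_n))` by `H2MuQZ.homQmodZChainEquiv`),
with `ℚ/ℤ` read as `QmodZ = ULift (AddCircle 1)`. [cite: MochizukiAbsTopIII2015, Proposition 3.2 (i) p.71] -/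
def genuineH2HomQmodZEquiv : (galCyclotomeH2 (absoluteGaloisGroup k) : Type) ≃+ (QmodZ.{0} →+ H2MuQZ k) :=
  (genuineH2ChainEquiv k R).trans
    (H2MuQZ.homQmodZChainEquiv.symm.trans (AddEquiv.addMonoidHomCongrLeft AddEquiv.ulift.symm))

/-- The homomorphism `ℚ/ℤ → H²(Γ_k, μ_{ℚ/ℤ})` attached to `c` takes at `1/(i+1)!` the value `of` (level-`(i+1)!`
class of `c`). [cite: MochizukiAbsTopIII2015, Proposition 3.2 (i) p.71] -/
theorem genuineH2HomQmodZEquiv_apply_up (c : (galCyclotomeH2 (absoluteGaloisGroup k) : Type)) (i : ℕ) :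
    genuineH2HomQmodZEquiv k R c (ULift.up ((((1 : ℚ) / ((cycLevel i : ℕ+) : ℕ) : ℚ)) : AddCircle (1 : ℚ))) =
      H2MuQZ.of (cycLevel i) (cohomologyMap ((galCyclotomeTower R.equiv R.equiv_smul).proj i) 2 c) := by
  change H2MuChainClasses.toHomQmodZ (genuineH2ChainEquiv k R c)
      ((((1 : ℚ) / ((cycLevel i : ℕ+) : ℕ) : ℚ)) : AddCircle (1 : ℚ)) = _
  rw [H2MuChainClasses.toHomQmodZ_apply_coe_one_div_cycLevel]
  rfl

/-- **THE `Ẑ`-level residue isomorphism of the genuine `H²`**: `H²(Γ_k, μ_Ẑ(G_k)) ⥲ Hom(ℚ/ℤ, H²(Γ_k, μ_{ℚ/ℤ}))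
⥲ Hom(ℚ/ℤ, ℚ/ℤ) ⥲ Ẑ`, the middle arrow being `Hom(ℚ/ℤ, inv)` for THE residue isomorphism `invariantQZEquiv`
(local class field theory) and the last `eEnd` (canonically `Prop32iChain.endQmodZCanonical`) — the printed
construction of Prop. 3.2 (i) p. 71 l. 57–60 / Cor. 1.10 (i)(a). [cite: MochizukiAbsTopIII2015, Proposition 3.2 (i) p.71] -/
def genuineH2Iso (eEnd : (QmodZ.{0} →+ QmodZ.{0}) ≃+ ZhatAdd.{0}) :
    (galCyclotomeH2 (absoluteGaloisGroup k) : Type) ≃+ ZhatAdd.{0} :=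
  (genuineH2HomQmodZEquiv k R).trans
    ((AddEquiv.addMonoidHomCongrRight ((invariantQZEquiv k).trans AddEquiv.ulift.symm)).trans eEnd)

/-! ### `genuineH2Iso` read levelwise: its `ℤ/(i+1)!`-coordinate is `inv_{(i+1)!}` of the level class -/

/-- `k • (1/n) = 0` in `ℚ/ℤ` forces `n ∣ k`. [cite: MochizukiAbsTopIII2015, Proposition 3.2 (i) p.71] -/
theorem natCast_dvd_of_zsmul_coe_one_div_eq_zero {n : ℕ} (hn : 0 < n) {m : ℤ}
    (h : m • ((((1 : ℚ) / n : ℚ)) : AddCircle (1 : ℚ)) = 0) : (n : ℤ) ∣ m := by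
  have h1 := (addOrderOf_dvd_iff_zsmul_eq_zero).2 h
  rwa [AddCircle.addOrderOf_period_div hn] at h1

/-- **`genuineH2Iso` IS the levelwise residue map** (with the canonical `End(ℚ/ℤ) ≅ Ẑ`): for
`c ∈ H²(Γ_k, μ_Ẑ(G_k))`, the `ℤ/(i+1)!`-coordinate of `genuineH2Iso c ∈ Ẑ` is `inv_{(i+1)!}` of the push-forward
of `c` to `H²(Γ_k, μ_{(i+1)!})` — i.e. `genuineH2Iso` agrees level by level with abc-iut-L4-t17's
`limitClassesToZModChain` (`CyclotomicSynchronizationCor110iaProofs.lean`, F-1387): the `Hom(ℚ/ℤ, −)`-route and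
the `lim_n inv_n`-route to «`H²(G_k, μ_Ẑ(G_k)) ⥲ Ẑ`» coincide. [cite: MochizukiAbsTopIII2015, Cor 1.10 (i) p.42] -/
theorem natCast_dvd_repn_genuineH2Iso_sub_invLevel (c : (galCyclotomeH2 (absoluteGaloisGroup k) : Type))
    (i : ℕ) :
    ((((cycLevel i : ℕ+) : ℕ) : ℤ)) ∣
      @ZHatCompletion.repn ((cycLevel i : ℕ+) : ℕ) ⟨(cycLevel i).ne_zero⟩
          (Additive.toMul (genuineH2Iso k R Prop32iChain.endQmodZCanonical c).down) -
        ((invLevel k ((cycLevel i : ℕ+) : ℕ)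
          (cohomologyMap ((galCyclotomeTower R.equiv R.equiv_smul).proj i) 2 c)).val : ℤ) := by
  haveI : NeZero ((cycLevel i : ℕ+) : ℕ) := ⟨(cycLevel i).ne_zero⟩
  -- the endomorphism of `ℚ/ℤ` underlying `genuineH2Iso c`: `u ↦ inv (f_c u)`
  let ψ : AddCircle (1 : ℚ) →+ AddCircle (1 : ℚ) :=
    (AddEquiv.ulift : QmodZ.{0} ≃+ AddCircle (1 : ℚ)).addMonoidHomCongrRight
      ((AddEquiv.ulift : QmodZ.{0} ≃+ AddCircle (1 : ℚ)).addMonoidHomCongrLeft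
        ((AddEquiv.addMonoidHomCongrRight
          ((invariantQZEquiv k).trans (AddEquiv.ulift : QmodZ.{0} ≃+ AddCircle (1 : ℚ)).symm))
          (genuineH2HomQmodZEquiv k R c)))
  have h1 : (genuineH2Iso k R Prop32iChain.endQmodZCanonical c).down =
      Additive.ofMul (ZHatCompletion.ofEnd ψ) := rfl
  have h2 : ψ ((((1 : ℚ) / ((cycLevel i : ℕ+) : ℕ) : ℚ)) : AddCircle (1 : ℚ)) =
      ((invLevel k ((cycLevel i : ℕ+) : ℕ)
          (cohomologyMap ((galCyclotomeTower R.equiv R.equiv_smul).proj i) 2 c)).val : ℤ) •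
        ((((1 : ℚ) / ((cycLevel i : ℕ+) : ℕ) : ℚ)) : AddCircle (1 : ℚ)) := by
    change invariantQZ k (genuineH2HomQmodZEquiv k R c (ULift.up _)) = _
    rw [genuineH2HomQmodZEquiv_apply_up, invariantQZ_of, ← AddCircle.coe_zsmul, zsmul_eq_mul,
      Int.cast_natCast, mul_one_div]
  have h3 := ZHatCompletion.apply_inv_eq_coeff_zsmul ψ (cycLevel i).pos
  rw [h2, ← sub_eq_zero, ← sub_smul] at h3
  have h4 := natCast_dvd_of_zsmul_coe_one_div_eq_zero (cycLevel i).pos h3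
  have h5 := ZHatCompletion.dvd_repn_ofEnd_sub_coeff ψ ((cycLevel i : ℕ+) : ℕ)
  rw [h1, toMul_ofMul]
  have := h5.add (dvd_sub_comm.1 h4)
  rwa [sub_add_sub_cancel] at this

/-- The same, against abc-iut-L4-t17's `limitClassesEquivZModChain` (F-1387's levelwise residue chain): the
`ℤ/(i+1)!`-coordinate of `genuineH2Iso c` is the `i`-th component of `limitClassesEquivZModChain (limitClassesEquiv c)`.
[cite: MochizukiAbsTopIII2015, Cor 1.10 (i) p.42] -/
theorem natCast_dvd_repn_genuineH2Iso_sub_limitClassesEquivZModChain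
    (c : (galCyclotomeH2 (absoluteGaloisGroup k) : Type)) (i : ℕ) :
    ((((cycLevel i : ℕ+) : ℕ) : ℤ)) ∣
      @ZHatCompletion.repn ((cycLevel i : ℕ+) : ℕ) ⟨(cycLevel i).ne_zero⟩
          (Additive.toMul (genuineH2Iso k R Prop32iChain.endQmodZCanonical c).down) -
        (((limitClassesEquivZModChain k R.equiv R.equiv_smul
          ((galCyclotomeTower R.equiv R.equiv_smul).limitClassesEquiv
            (finite_H1_galCyclotomeTower k R.equiv R.equiv_smul) c)).1 i).val : ℤ) :=
  natCast_dvd_repn_genuineH2Iso_sub_invLevel k R c i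

end Prop121vii

/-! ### The genuine Kummer theory of the model -/

namespace ModelMLFGaloisData

open Prop121vii

variable {k : Type} [Field k] [ValuativeRel k] [TopologicalSpace k] [IsNonarchimedeanLocalField k] [CharZero k]

/-- **The model Kummer theory with the GENUINE `H²`-slot**: abc-iut-L4-t2's `D.kummerTheory` (Kummer maps on
`H¹(H, Λ(k̄ˣ))`, limit map, additive structure — re-used verbatim) with `coh.H2 := H²(Γ_k, μ_Ẑ(G_k))` and
`h2Iso := genuineH2Iso R eEnd` («(i) the natural isomorphism `H²(G, μ_Ẑ(M_TM)) ⥲ Ẑ`»).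
[cite: MochizukiAbsTopIII2015, Proposition 3.2 (i) p.71] -/
def genuineKummerTheory (D : ModelMLFGaloisData (MLFClosure.std k).k (MLFClosure.std k).K)
    (R : TorsionReciprocityData k) (eEnd : (QmodZ.{0} →+ QmodZ.{0}) ≃+ ZhatAdd.{0}) :
    MonoidKummerTheory D.tmPair :=
  { D.kummerTheory (MLFClosure.std k) with
    coh := { (D.kummerTheory (MLFClosure.std k)).coh with
      H2 := (galCyclotomeH2 (absoluteGaloisGroup k) : Type)
      grpH2 := inferInstance }
    h2Iso := genuineH2Iso k R eEnd }

/-- The `H²`-slot of the genuine Kummer theory is `H²(Γ_k, μ_Ẑ(G_k))`. [cite: MochizukiAbsTopIII2015, Proposition 3.2 (i) p.71] -/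
theorem genuineKummerTheory_coh_H2 (D : ModelMLFGaloisData (MLFClosure.std k).k (MLFClosure.std k).K)
    (R : TorsionReciprocityData k) (eEnd : (QmodZ.{0} →+ QmodZ.{0}) ≃+ ZhatAdd.{0}) :
    (D.genuineKummerTheory R eEnd).coh.H2 = (galCyclotomeH2 (absoluteGaloisGroup k) : Type) := rfl

/-- Its `h2Iso` is `genuineH2Iso`. [cite: MochizukiAbsTopIII2015, Proposition 3.2 (i) p.71] -/
theorem genuineKummerTheory_h2Iso (D : ModelMLFGaloisData (MLFClosure.std k).k (MLFClosure.std k).K)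
    (R : TorsionReciprocityData k) (eEnd : (QmodZ.{0} →+ QmodZ.{0}) ≃+ ZhatAdd.{0}) :
    (D.genuineKummerTheory R eEnd).h2Iso = genuineH2Iso k R eEnd := rfl

/-- Its Kummer maps are those of `D.kummerTheory` (unchanged). [cite: MochizukiAbsTopIII2015, Proposition 3.2 (ii) p.71] -/
theorem genuineKummerTheory_kummer (D : ModelMLFGaloisData (MLFClosure.std k).k (MLFClosure.std k).K)
    (R : TorsionReciprocityData k) (eEnd : (QmodZ.{0} →+ QmodZ.{0}) ≃+ ZhatAdd.{0}) :
    (D.genuineKummerTheory R eEnd).kummer = (D.kummerTheory (MLFClosure.std k)).kummer := rfl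

end ModelMLFGaloisData

namespace Prop121vii

variable {k : Type} [Field k] [ValuativeRel k] [TopologicalSpace k] [IsNonarchimedeanLocalField k] [CharZero k]
variable (R : TorsionReciprocityData k)
variable (D : ModelMLFGaloisData (MLFClosure.std k).k (MLFClosure.std k).K)

/-- **The printed Brauer chain of Prop. 3.2 (i) over the GENUINE Kummer theory**: the Brauer arrows of
`modelChain` (real carriers: `H2MuQZ k`, `H²(Γ_k, k̄ˣ)`, `H²(Gal(k^nr/k), (k̄ˣ)^{I_k})`, `H²(Gal(k^nr/k), ℤ)`; `e₃`,
`e₄`, `eEnd` parameters as there) and `homQmodZ := (genuineH2HomQmodZEquiv R)⁻¹ :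
Hom(ℚ/ℤ, H²(Γ_k, μ_{ℚ/ℤ})) ⥲ H²(Γ_k, μ_Ẑ(G_k))` — «applying the functor `Hom(ℚ/ℤ, −)`» for real.
[cite: MochizukiAbsTopIII2015, Proposition 3.2 (i) p.71] -/
def genuineChain (Hmid : Type) [AddCommGroup Hmid]
    (e₃ : (continuousCohomology 2 (((units k).quotientInvariants (galUnr k)).toTopRep) : TopModuleCat ℤ) ≃+
      Hmid)
    (e₄ : Hmid ≃+ (continuousCohomology 2
      (ContinuousRep.trivial (absoluteGaloisGroup k ⧸ galUnr k) ℤ ZCoeff.{0}).toTopRep : TopModuleCat ℤ))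
    (eEnd : (QmodZ.{0} →+ QmodZ.{0}) ≃+ ZhatAdd.{0}) :
    Prop32iChain (D.genuineKummerTheory R eEnd) where
  H2muQZ := H2MuQZ k
  H2Mgp := galoisCohomology (units k) 2
  brauerKummer := brauerKummerQZEquiv k
  H2unr := (continuousCohomology 2 (((units k).quotientInvariants (galUnr k)).toTopRep) : TopModuleCat ℤ)
  inflUnr := inflUnrEquiv k
  H2unrVal := Hmid
  unitsAcyclic := e₃
  H2ZhatZ := (continuousCohomology 2
      (ContinuousRep.trivial (absoluteGaloisGroup k ⧸ galUnr k) ℤ ZCoeff.{0}).toTopRep : TopModuleCat ℤ)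
  valGen := e₄
  toQmodZ := toQmodZEquiv k
  homQmodZ := (genuineH2HomQmodZEquiv k R).symm
  endQmodZ := eEnd

variable {R D}

/-- The chain composite `invariant` of the genuine chain is that of `modelChain` (same Brauer arrows).
[cite: MochizukiAbsTopIII2015, Proposition 3.2 (i) p.71] -/
theorem genuineChain_invariant (Hmid : Type) [AddCommGroup Hmid] (e₃) (e₄)
    (eEnd : (QmodZ.{0} →+ QmodZ.{0}) ≃+ ZhatAdd.{0}) :
    (genuineChain R D Hmid e₃ e₄ eEnd).invariant = (modelChain k D Hmid e₃ e₄ eEnd).invariant :=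
  rfl

/-- Abstract core of the criterion: `E ≫ Hom(Q, inv) ≫ eEnd = E⁻¹⁻¹ ≫ H ≫ eEnd` with `H` = post-composition with `J`
iff `J = inv`. [cite: MochizukiAbsTopIII2015, Proposition 3.2 (i) p.71] -/
theorem trans_congr_eq_symm_symm_trans_iff {W X Q Z : Type} [AddCommGroup W] [AddCommGroup X] [AddCommGroup Q]
    [AddCommGroup Z] (E : W ≃+ (Q →+ X)) (inv J : X ≃+ Q) (eEnd : (Q →+ Q) ≃+ Z) (H : (Q →+ X) ≃+ (Q →+ Q))
    (hH : ∀ f, H f = J.toAddMonoidHom.comp f) :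
    E.trans ((AddEquiv.addMonoidHomCongrRight inv).trans eEnd) = E.symm.symm.trans (H.trans eEnd) ↔
      J = inv := by
  constructor
  · intro h
    have key : ∀ f : Q →+ X, inv.toAddMonoidHom.comp f = J.toAddMonoidHom.comp f := by
      intro f
      have h1 := AddEquiv.congr_fun h (E.symm f)
      rw [AddEquiv.trans_apply, AddEquiv.trans_apply, AddEquiv.symm_symm, AddEquiv.trans_apply,
        AddEquiv.trans_apply, AddEquiv.apply_symm_apply, hH] at h1
      exact eEnd.injective h1
    ext x
    have h2 := DFunLike.congr_fun (key inv.symm.toAddMonoidHom) (inv x)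
    simp only [AddMonoidHom.coe_comp, Function.comp_apply, AddEquiv.coe_toAddMonoidHom,
      AddEquiv.symm_apply_apply] at h2
    exact h2.symm
  · rintro rfl
    refine AddEquiv.ext fun w => ?_
    rw [AddEquiv.trans_apply, AddEquiv.trans_apply, AddEquiv.symm_symm, AddEquiv.trans_apply,
      AddEquiv.trans_apply, hH]
    rfl

/-- **Prop. 3.2 (i) for the model with GENUINE `H²` — THE CRITERION.**  `H2IsoEq` for the genuine chain (the
`Ẑ`-level residue isomorphism `genuineH2Iso` IS the printed chain composite through `Hom(ℚ/ℤ, −)`) holds iff the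
printed Brauer-route composite `brauerKummer ≫ inflUnr⁻¹ ≫ e₃ ≫ e₄ ≫ toQmodZ : H²(Γ_k, μ_{ℚ/ℤ}) ⥲ ℚ/ℤ` IS the
residue map `invariantQZEquiv k` — independently of `eEnd` and of `R`.
[cite: MochizukiAbsTopIII2015, Proposition 3.2 (i) p.71] -/
theorem genuineChain_h2IsoEq_iff (Hmid : Type) [AddCommGroup Hmid] (e₃) (e₄)
    (eEnd : (QmodZ.{0} →+ QmodZ.{0}) ≃+ ZhatAdd.{0}) :
    (genuineChain R D Hmid e₃ e₄ eEnd).H2IsoEq ↔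
      (genuineChain R D Hmid e₃ e₄ eEnd).invariant = (invariantQZEquiv k).trans AddEquiv.ulift.symm :=
  trans_congr_eq_symm_symm_trans_iff (genuineH2HomQmodZEquiv k R)
    ((invariantQZEquiv k).trans AddEquiv.ulift.symm) (genuineChain R D Hmid e₃ e₄ eEnd).invariant eEnd
    (genuineChain R D Hmid e₃ e₄ eEnd).homInvariant (fun _ => rfl)

/-- Levelwise form of the criterion: `H2IsoEq` iff the Brauer-route composite sends every level-`n` class `x` to
`inv_n(x)/n`. [cite: MochizukiAbsTopIII2015, Proposition 3.2 (i) p.71] -/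
theorem genuineChain_h2IsoEq_iff_levelwise (Hmid : Type) [AddCommGroup Hmid] (e₃) (e₄)
    (eEnd : (QmodZ.{0} →+ QmodZ.{0}) ≃+ ZhatAdd.{0}) :
    (genuineChain R D Hmid e₃ e₄ eEnd).H2IsoEq ↔
      ∀ (n : ℕ+) (x : galoisCohomology (mu k (n : ℕ)) 2),
        (modelChain k D Hmid e₃ e₄ eEnd).invariant (H2MuQZ.of n x) =
          ULift.up ((((((invLevel k (n : ℕ) x).val : ℚ)) / (n : ℕ) : ℚ) : AddCircle (1 : ℚ))) :=
  (genuineChain_h2IsoEq_iff Hmid e₃ e₄ eEnd).trans (eq_invariantQZEquiv_iff_levelwise _)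

variable (R D)

/-- **The genuine chain with EVERY Brauer arrow from the tree** (`unitsAcyclic := unrValuationH2Equiv`,
`valGen := ε` the orientation of «`H²(Ẑ, ℤ) ⥲ ℚ/ℤ`»), cf. `modelChainStd`. [cite: MochizukiAbsTopIII2015, Proposition 3.2 (i) p.71] -/
abbrev genuineChainStd
    (ε : (continuousCohomology 2
        (ContinuousRep.trivial (absoluteGaloisGroup k ⧸ galUnr k) ℤ ZCoeff.{0}).toTopRep : TopModuleCat ℤ) ≃+
      (continuousCohomology 2
        (ContinuousRep.trivial (absoluteGaloisGroup k ⧸ galUnr k) ℤ ZCoeff.{0}).toTopRep : TopModuleCat ℤ))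
    (eEnd : (QmodZ.{0} →+ QmodZ.{0}) ≃+ ZhatAdd.{0}) :
    Prop32iChain (D.genuineKummerTheory R eEnd) :=
  genuineChain R D _ (unrValuationH2Equiv k) ε eEnd

variable {R D}

/-- **Prop. 3.2 (i) HOLDS for the model with GENUINE `H²`** (orientation `ε = −id`, every `eEnd`, every
torsion-reciprocity datum `R`): the `Ẑ`-level residue isomorphism `H²(Γ_k, μ_Ẑ(G_k)) ⥲ Ẑ` obtained by «applying
`Hom(ℚ/ℤ, −)`» to THE residue map IS the composite of the printed Brauer chain — every arrow a kernel
construction of the tree (abc-iut-w5-d198/d201/d214, L4-t16/t17, w4-d045 and this seat).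
[cite: MochizukiAbsTopIII2015, Proposition 3.2 (i) p.71] -/
theorem genuineChainStd_neg_h2IsoEq (eEnd : (QmodZ.{0} →+ QmodZ.{0}) ≃+ ZhatAdd.{0}) :
    (genuineChainStd R D (AddEquiv.neg _) eEnd).H2IsoEq :=
  (genuineChain_h2IsoEq_iff_levelwise (R := R) (D := D) _ (unrValuationH2Equiv k) (AddEquiv.neg _) eEnd).2
    fun n x => modelChainStd_neg_invariant_of (D := D) eEnd n x

/-- … and FAILS with abc-iut-L4-t16's orientation `ε = id` (the tree's sign convention, as for the placeholder
chain: `not_modelChainStd_refl_h2IsoEq`). [cite: MochizukiAbsTopIII2015, Proposition 3.2 (i) p.71] -/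
theorem not_genuineChainStd_refl_h2IsoEq (eEnd : (QmodZ.{0} →+ QmodZ.{0}) ≃+ ZhatAdd.{0}) :
    ¬ (genuineChainStd R D (AddEquiv.refl _) eEnd).H2IsoEq := by
  intro h
  have h' := (genuineChain_h2IsoEq_iff (R := R) (D := D) _ (unrValuationH2Equiv k) (AddEquiv.refl _) eEnd).1 h
  exact not_modelChainStd_refl_h2IsoEq (D := D) eEnd
    ((modelChain_h2IsoEq_iff (k := k) (D := D) _ (unrValuationH2Equiv k) (AddEquiv.refl _) eEnd).2 h')

/-- **Hypothesis-free packaging**: for every `p`-adic local field `k` (char. `0`) and model datum `D` there is a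
Kummer theory of the model pair `(Π_k ↷ 𝒪_k̄^⊳)` whose `H²`-slot is the genuine `H²(Γ_k, μ_Ẑ(G_k))`, whose `H¹`-data are
abc-iut-L4-t2's, and for which the printed chain of Prop. 3.2 (i) satisfies `H2IsoEq` (torsion-reciprocity data
exist by local class field theory: `nonempty_torsionReciprocityData`, abc-iut-L6-t11).
[cite: MochizukiAbsTopIII2015, Proposition 3.2 (i) p.71] -/
theorem exists_genuineKummerTheory_h2IsoEq (D : ModelMLFGaloisData (MLFClosure.std k).k (MLFClosure.std k).K) :
    ∃ (T : MonoidKummerTheory D.tmPair) (C : Prop32iChain T),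
      T.coh.H2 = (galCyclotomeH2 (absoluteGaloisGroup k) : Type) ∧
        T.coh.H1 = (D.kummerTheory (MLFClosure.std k)).coh.H1 ∧ C.endQmodZ = Prop32iChain.endQmodZCanonical ∧
          C.H2IsoEq := by
  obtain ⟨R⟩ := nonempty_torsionReciprocityData k
  exact ⟨D.genuineKummerTheory R Prop32iChain.endQmodZCanonical,
    genuineChainStd R D (AddEquiv.neg _) Prop32iChain.endQmodZCanonical, rfl, rfl, rfl,
    genuineChainStd_neg_h2IsoEq Prop32iChain.endQmodZCanonical⟩

end Prop121vii

end Literature.AnabelianGeometry.AbsoluteAnabelian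

end
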